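import Mathlib.Analysis.SpecialFunctions.Exp
import Literature.Computability.AlgebraicComplexity.PermutationCommutant
import Literature.Computability.AlgebraicComplexity.SubspaceProjection
import Literature.Computability.AlgebraicComplexity.QuantumFunctionalSpectral
import HarnessLib

/-!
# The weight of `ρ^{⊗n}` on the commutant span of few words is small

Topic: `Literature/Computability/AlgebraicComplexity`; the single-system estimate at the heart of the
elementary proof of CVZ Thm. 3.34 (`ChristandlVranaZuiddam2023_le_upperSupportFunctional`,
`QuantumFunctionals.lean`). In the printed proof (Christandl–Vrana–Zuiddam, J. Amer. Math. Soc. 36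
(2023), Thm. 3.24 with Thm. 3.27 = Keyl–Werner spectrum estimation, and Rem. 3.33) the role of this file
is played by two facts of Schur–Weyl theory: the isotypic components `P_λ` of `(ℂ^d)^{⊗n}` carrying
`ρ^{⊗n}` have normalised highest weight `λ/n` of entropy `≈ H(spec ρ)` (Keyl–Werner), and an isotypic
component met by a standard basis word `e_u` has `H(type u / n) ≥ H(λ/n)` (majorisation). Here both
are replaced by one elementary statement about the *commutant span* `𝒲(L)` of a set `L` of words
(`PermutationCommutant.lean`):

* `trace_proj_powMat_le` — **main estimate.** Let `ρ` be a Hermitian matrix with eigenvalues `N rᵢ`,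
  `r` a probability vector with `H(r) = c`, let `ε > 0`, and let `L n` be sets of words of length `n`
  over another alphabet `ι` with `|L n| ≤ (n+1)^{|ι|} 2^{n(c-ε)}`. Then for every `δ > 0` and all large
  `n`, every Hermitian `P` projecting onto `𝒲(L n)` satisfies `re tr(P ρ^{⊗n}) ≤ δ N^n`.
  Proof: `ρ = U D U⋆`, and `U^{⊗n}` lies in the commutant and preserves `𝒲`, so
  `tr(P ρ^{⊗n}) = tr(P D^{⊗n}) = N^n ∑ᵤ P_{uu} r^u`; words of empirical entropy `≤ c - ε/2` carry total
  `r^{⊗n}`-mass `O(1/n)` (Chebyshev, `WordTypes.lean`) and `P_{uu} ≤ 1`; on the other words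
  `r^u ≤ 2^{-n(c-ε/2)}` (Gibbs) while `∑ᵤ P_{uu} = tr P = dim 𝒲 ≤ (n+1)^{|ι'||ι|} |L n|`, a net factor
  `poly(n) 2^{-nε/2}`.
* `exists_nat_pow_mul_exp_neg_le` — `(n+1)^K e^{-an} ≤ δ` for large `n` (`a > 0`).

No definitions are introduced.
-/

noncomputable section

open scoped BigOperators Matrix ComplexOrder
open Filter
open _root_.Topology

namespace Literature.Computability.AlgebraicComplexity

/-! ## Polynomial times decaying exponential -/

section Asymptotics

/-- `(n+1)^K · exp(-a n) → 0` for `a > 0`, in the form: eventually `≤ δ`. [folklore] -/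
theorem exists_nat_pow_mul_exp_neg_le (K : ℕ) {a : ℝ} (ha : 0 < a) {δ : ℝ} (hδ : 0 < δ) :
    ∃ n₀ : ℕ, ∀ n : ℕ, n₀ ≤ n → ((n : ℝ) + 1) ^ K * Real.exp (-(a * n)) ≤ δ := by
  -- `x ↦ x^K e^{-x}` tends to `0`; substitute `x = a (n + 1)`
  have h1 : Tendsto (fun n : ℕ => a * ((n : ℝ) + 1)) atTop atTop :=
    Tendsto.const_mul_atTop ha (tendsto_natCast_atTop_atTop.atTop_add tendsto_const_nhds)
  have h2 := (Real.tendsto_pow_mul_exp_neg_atTop_nhds_zero K).comp h1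
  have h3 : Tendsto (fun n : ℕ => (Real.exp a / a ^ K) *
      ((a * ((n : ℝ) + 1)) ^ K * Real.exp (-(a * ((n : ℝ) + 1))))) atTop (𝓝 0) := by
    simpa using h2.const_mul (Real.exp a / a ^ K)
  have heq : ∀ n : ℕ, (Real.exp a / a ^ K) * ((a * ((n : ℝ) + 1)) ^ K * Real.exp (-(a * ((n : ℝ) + 1))))
      = ((n : ℝ) + 1) ^ K * Real.exp (-(a * n)) := by
    intro n
    have haK : a ^ K ≠ 0 := pow_ne_zero _ ha.ne'
    have hee : Real.exp a * Real.exp (-a) = 1 := by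
      rw [← Real.exp_add, add_neg_cancel, Real.exp_zero]
    rw [mul_pow, show -(a * ((n : ℝ) + 1)) = -(a * n) + -a by ring, Real.exp_add]
    field_simp
    linear_combination hee
  simp_rw [heq] at h3
  obtain ⟨n₀, hn₀⟩ := eventually_atTop.1 (h3.eventually (gt_mem_nhds hδ))
  exact ⟨n₀, fun n hn => (hn₀ n hn).le⟩

end Asymptotics

/-! ## The main estimate -/

section Estimate

variable {ι ι' : Type*} [Fintype ι] [Fintype ι'] [DecidableEq ι] [DecidableEq ι']

omit [Fintype ι'] in
/-- The diagonal factor of `ρ^{⊗n}`: with eigenvalues `N rᵢ`, the Kronecker power of the diagonalised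
matrix is diagonal with entries `N^n ∏ₘ r(uₘ)`. [folklore] -/
theorem powMat_diagonal_eigen {N : ℝ} {r : ι' → ℝ} {ev : ι' → ℝ} (hev : ∀ i, ev i = N * r i) (n : ℕ) :
    powMat (Matrix.diagonal (RCLike.ofReal ∘ ev : ι' → ℂ)) n =
      Matrix.diagonal fun u : Fin n → ι' => (((N ^ n * ∏ m, r (u m) : ℝ)) : ℂ) := by
  rw [powMat_diagonal, RCLike.ofReal_eq_complex_ofReal]
  congr 1
  funext u
  simp only [Function.comp_apply, hev]
  push_cast
  rw [Finset.prod_mul_distrib, Finset.prod_const, Finset.card_univ, Fintype.card_fin]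

/-- `re tr(D P) = ∑ᵤ dᵤ · re P_{uu}` for a real diagonal `D`. [folklore] -/
theorem re_trace_diagonal_mul {n : ℕ} (d : (Fin n → ι') → ℝ) (P : Matrix (Fin n → ι') (Fin n → ι') ℂ) :
    ((Matrix.diagonal fun u => (d u : ℂ)) * P).trace.re = ∑ u, d u * (P u u).re := by
  simp only [Matrix.trace, Matrix.diag, Matrix.diagonal_mul, Complex.re_sum, Complex.re_ofReal_mul]

/-- **Main estimate** (the elementary substitute for Keyl–Werner spectrum estimation plus the
majorisation property, CVZ Thm. 3.27 / Rem. 3.33): see the module docstring. For a Hermitian `ρ`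
with eigenvalues `N rᵢ` (`r` a probability vector, `H(r) = c`, `N > 0`), `ε > 0`, and sets `L n` of
words over `ι` with `|L n| ≤ (n+1)^{|ι|} e^{(n log 2)(c-ε)}`: for every `δ > 0` there is `n₀` such that
for all `n ≥ n₀` every Hermitian `P` fixing `𝒲(L n)` pointwise and mapping into `𝒲(L n)` has
`re tr(P ρ^{⊗n}) ≤ δ N^n`. [folklore] -/
theorem trace_proj_powMat_le {ρ : Matrix ι' ι' ℂ} (hρ : ρ.IsHermitian) {N : ℝ} (hN : 0 < N)
    {r : ι' → ℝ} (hr : r ∈ stdSimplex ℝ ι') (hev : ∀ i, hρ.eigenvalues i = N * r i) {c ε : ℝ}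
    (hc : shannonEntropy r = c) (hε : 0 < ε) (L : ∀ n : ℕ, Finset (Fin n → ι))
    (hL : ∀ n : ℕ, 0 < n →
      ((L n).card : ℝ) ≤ ((n : ℝ) + 1) ^ Fintype.card ι * Real.exp (n * Real.log 2 * (c - ε)))
    {δ : ℝ} (hδ : 0 < δ) :
    ∃ n₀ : ℕ, ∀ n : ℕ, n₀ ≤ n → ∀ P : Matrix (Fin n → ι') (Fin n → ι') ℂ, P.IsHermitian →
      (∀ w ∈ commutantSpan ι' (L n), P *ᵥ w = w) → (∀ v, P *ᵥ v ∈ commutantSpan ι' (L n)) →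
      (P * powMat ρ n).trace.re ≤ δ * N ^ n := by
  classical
  have hr0 : ∀ i, 0 ≤ r i := hr.1
  have hr1 : ∑ i, r i = 1 := hr.2
  -- (a) Chebyshev: words of empirical entropy `≤ c - ε/2` have small `r^{⊗n}`-mass
  obtain ⟨C, hC0, hC⟩ := exists_sum_prod_filter_entropy_le hr0 hr1 (half_pos hε)
  -- (b) the polynomial-exponential factor
  set K := Fintype.card ι' * Fintype.card ι + Fintype.card ι with hK
  have ha : 0 < Real.log 2 * (ε / 2) := mul_pos (Real.log_pos one_lt_two) (half_pos hε)
  obtain ⟨n₁, hn₁⟩ := exists_nat_pow_mul_exp_neg_le K ha (half_pos hδ)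
  -- (c) `C / n ≤ δ / 2` for large `n`
  obtain ⟨n₂, hn₂⟩ := exists_nat_gt (2 * C / δ)
  refine ⟨max (max n₁ n₂) 1, fun n hn P hP hfix hinto => ?_⟩
  have hn1 : n₁ ≤ n := le_trans (le_trans (le_max_left _ _) (le_max_left _ _)) hn
  have hn2 : n₂ ≤ n := le_trans (le_trans (le_max_right _ _) (le_max_left _ _)) hn
  have hnpos : 0 < n := lt_of_lt_of_le Nat.one_pos (le_trans (le_max_right _ _) hn)
  have hnR : (0 : ℝ) < n := by exact_mod_cast hnpos
  -- spectral factorisation and reduction to the diagonal case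
  obtain ⟨U, hU1, hU2, hρU⟩ := IsHermitianAux.spectral_factorisation hρ
  set D : Matrix ι' ι' ℂ := Matrix.diagonal (RCLike.ofReal ∘ hρ.eigenvalues) with hD
  set w : (Fin n → ι') → ℝ := fun u => ∏ m, r (u m) with hw
  have hw0 : ∀ u, 0 ≤ w u := fun u => Finset.prod_nonneg fun _ _ => hr0 _
  have hDn : powMat D n = Matrix.diagonal fun u : Fin n → ι' => ((N ^ n * w u : ℝ) : ℂ) :=
    powMat_diagonal_eigen hev n
  -- `U^{⊗n}` and its adjoint preserve `𝒲`
  have hUW : ∀ v ∈ commutantSpan ι' (L n), powMat U n *ᵥ v ∈ commutantSpan ι' (L n) :=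
    fun v hv => (IsPermInvariant.powMat U n).mulVec_mem_commutantSpan hv
  have hUW' : ∀ v ∈ commutantSpan ι' (L n), star (powMat U n) *ᵥ v ∈ commutantSpan ι' (L n) := by
    intro v hv
    rw [star_powMat]
    exact (IsPermInvariant.powMat (star U) n).mulVec_mem_commutantSpan hv
  have hUn : star (powMat U n) * powMat U n = 1 := by
    rw [star_powMat]; exact powMat_star_mul_self hU1 n
  have hconj : star (powMat U n) * P * powMat U n = P :=
    star_mul_proj_mul_eq_of_maps hP hfix hinto hUn hUW hUW'
  -- `tr(P ρ^{⊗n}) = tr(D^{⊗n} P)`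
  have htr : (P * powMat ρ n).trace = (powMat D n * P).trace := by
    rw [hρU, powMat_mul, powMat_mul, ← star_powMat]
    calc (P * (powMat U n * powMat D n * star (powMat U n))).trace
        = (P * powMat U n * powMat D n * star (powMat U n)).trace := by
          simp only [Matrix.mul_assoc]
      _ = (star (powMat U n) * (P * powMat U n * powMat D n)).trace := Matrix.trace_mul_comm _ _
      _ = (star (powMat U n) * P * powMat U n * powMat D n).trace := by
          simp only [Matrix.mul_assoc]
      _ = (P * powMat D n).trace := by rw [hconj]
      _ = (powMat D n * P).trace := Matrix.trace_mul_comm _ _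
  rw [htr, hDn, re_trace_diagonal_mul]
  -- now estimate `∑ᵤ N^n w(u) re P_{uu}`
  have hPP : P * P = P := mul_self_of_proj hfix hinto
  have hdiag0 : ∀ u, 0 ≤ (P u u).re := fun u => proj_diag_re_nonneg hP hPP u
  have hdiag1 : ∀ u, (P u u).re ≤ 1 := fun u => proj_diag_re_le_one hP hPP u
  -- the trace of `P` is the dimension of `𝒲`, bounded by the counting estimates
  have htrP : ∑ u, (P u u).re ≤ ((n : ℝ) + 1) ^ K * Real.exp (n * Real.log 2 * (c - ε)) := by
    have h1 : ∑ u, (P u u).re = (Module.finrank ℂ (commutantSpan ι' (L n)) : ℝ) := by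
      have h := congrArg Complex.re (trace_eq_finrank_of_proj hP hfix hinto)
      simpa [Matrix.trace, Matrix.diag, Complex.re_sum] using h
    rw [h1]
    have h2 : (Module.finrank ℂ (commutantSpan ι' (L n)) : ℝ) ≤
        ((n : ℝ) + 1) ^ (Fintype.card ι' * Fintype.card ι) * (L n).card := by
      exact_mod_cast finrank_commutantSpan_le_pow (ι' := ι') (L n)
    refine h2.trans ?_
    rw [hK, pow_add, mul_assoc]
    exact mul_le_mul_of_nonneg_left (hL n hnpos) (pow_nonneg (by positivity) _)
  -- split the words according to their empirical entropy
  set low : (Fin n → ι') → Prop := fun u =>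
    shannonEntropy (fun i => (letterCount u i : ℝ) / n) ≤ shannonEntropy r - ε / 2 with hlow
  have hsplit := Finset.sum_filter_add_sum_filter_not Finset.univ low
    (fun u => N ^ n * w u * (P u u).re)
  have hNn : 0 < N ^ n := pow_pos hN n
  -- low-entropy words: `re P_{uu} ≤ 1` and Chebyshev
  have hA : ∑ u ∈ Finset.univ.filter low, N ^ n * w u * (P u u).re ≤ N ^ n * (C / n) := by
    calc ∑ u ∈ Finset.univ.filter low, N ^ n * w u * (P u u).re
        ≤ ∑ u ∈ Finset.univ.filter low, N ^ n * w u := by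
          refine Finset.sum_le_sum fun u _ => ?_
          have := mul_le_mul_of_nonneg_left (hdiag1 u) (mul_nonneg hNn.le (hw0 u))
          simpa using this
      _ = N ^ n * ∑ u ∈ Finset.univ.filter low, w u := by rw [Finset.mul_sum]
      _ ≤ N ^ n * (C / n) := mul_le_mul_of_nonneg_left (hC n hnpos) hNn.le
  -- high-entropy words: Gibbs bound on `w u` and the trace bound
  have hB : ∑ u ∈ Finset.univ.filter (fun u => ¬low u), N ^ n * w u * (P u u).re ≤
      N ^ n * (Real.exp (-(n * Real.log 2) * (c - ε / 2)) *
        (((n : ℝ) + 1) ^ K * Real.exp (n * Real.log 2 * (c - ε)))) := by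
    have hwle : ∀ u, ¬low u → w u ≤ Real.exp (-(n * Real.log 2) * (c - ε / 2)) := by
      intro u hu
      refine (prod_apply_le_exp_entropy hnpos hr0 hr1.le u).trans ?_
      rw [Real.exp_le_exp]
      have hlt : shannonEntropy r - ε / 2 < shannonEntropy (fun i => (letterCount u i : ℝ) / n) :=
        not_le.1 hu
      rw [hc] at hlt
      have h2 : 0 ≤ (n : ℝ) * Real.log 2 := mul_nonneg hnR.le (Real.log_nonneg one_le_two)
      nlinarith [mul_le_mul_of_nonneg_left hlt.le h2]
    calc ∑ u ∈ Finset.univ.filter (fun u => ¬low u), N ^ n * w u * (P u u).re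
        ≤ ∑ u ∈ Finset.univ.filter (fun u => ¬low u),
            N ^ n * Real.exp (-(n * Real.log 2) * (c - ε / 2)) * (P u u).re := by
          refine Finset.sum_le_sum fun u hu => ?_
          have hu' : ¬low u := (Finset.mem_filter.1 hu).2
          exact mul_le_mul_of_nonneg_right (mul_le_mul_of_nonneg_left (hwle u hu') hNn.le)
            (hdiag0 u)
      _ ≤ ∑ u, N ^ n * Real.exp (-(n * Real.log 2) * (c - ε / 2)) * (P u u).re :=
          Finset.sum_le_sum_of_subset_of_nonneg (Finset.filter_subset _ _) fun u _ _ =>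
            mul_nonneg (mul_nonneg hNn.le (Real.exp_pos _).le) (hdiag0 u)
      _ = N ^ n * (Real.exp (-(n * Real.log 2) * (c - ε / 2)) * ∑ u, (P u u).re) := by
          rw [Finset.mul_sum, Finset.mul_sum]
          exact Finset.sum_congr rfl fun u _ => by ring
      _ ≤ N ^ n * (Real.exp (-(n * Real.log 2) * (c - ε / 2)) *
            (((n : ℝ) + 1) ^ K * Real.exp (n * Real.log 2 * (c - ε)))) :=
          mul_le_mul_of_nonneg_left (mul_le_mul_of_nonneg_left htrP (Real.exp_pos _).le) hNn.le
  -- combine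
  have hexp : Real.exp (-(n * Real.log 2) * (c - ε / 2)) *
      (((n : ℝ) + 1) ^ K * Real.exp (n * Real.log 2 * (c - ε))) =
      ((n : ℝ) + 1) ^ K * Real.exp (-(Real.log 2 * (ε / 2) * n)) := by
    rw [mul_left_comm, ← Real.exp_add]
    congr 1
    ring_nf
  have hCn : C / n ≤ δ / 2 := by
    rw [div_le_iff₀ hnR]
    have h2 : (n₂ : ℝ) ≤ n := by exact_mod_cast hn2
    have h3 : 2 * C / δ < n := lt_of_lt_of_le hn₂ h2
    rw [div_lt_iff₀ hδ] at h3
    linarith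
  calc ∑ u, N ^ n * w u * (P u u).re
      = ∑ u ∈ Finset.univ.filter low, N ^ n * w u * (P u u).re +
          ∑ u ∈ Finset.univ.filter (fun u => ¬low u), N ^ n * w u * (P u u).re := hsplit.symm
    _ ≤ N ^ n * (C / n) + N ^ n * (((n : ℝ) + 1) ^ K * Real.exp (-(Real.log 2 * (ε / 2) * n))) := by
          rw [← hexp]; exact add_le_add hA hB
    _ ≤ N ^ n * (δ / 2) + N ^ n * (δ / 2) :=
          add_le_add (mul_le_mul_of_nonneg_left hCn hNn.le)
            (mul_le_mul_of_nonneg_left (hn₁ n hn1) hNn.le)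
    _ = δ * N ^ n := by ring

end Estimate

end Literature.Computability.AlgebraicComplexity
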